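import Literature.GroupTheory.CombinatorialGroupTheory.FreeGroupSubgroupSeparable
import Summits.SmoothPoincare4.SmoothPoincare4.Theorems.CongruenceShadowsShadowApproximationEpiClassLivingstonDefs
import Summits.SmoothPoincare4.SmoothPoincare4.Theorems.WaldhausenPairs.Negative.LoadBearing

/-!
# Stub `stub_hallClosure` of line `free-shadow-tsystem` for crux `CongruenceShadows.ShadowApproximation`
(item stmt-SmoothPoincare4-14595, route route-SmoothPoincare4-CongruenceShadows) — the profinite-to-discrete step

Notation: `S = SurfaceGroup (3+3m)`, `N = s4Kernels.stabilizeIter m` (the standard `(3+3m; m+1)`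
kernel triple of `S⁴`), `F = S ⧸ N 0` (`= π₁` of the standard handlebody `H₀`, a free group),
`π = QuotientGroup.mk' (N 0)`, `Ū = π(N 1) ≤ F` (normal).

**`stub_hallClosure`** (registered signature, verbatim): a finitely generated `H ≤ F` with
`H ⊔ P = ⊤` for every normal finite-index `P ≥ Ū` satisfies `H ⊔ Ū = ⊤`.

Proof.  §1 `F ⧸ Ū` is free: `N` is a `(3+3m, m+1)` group trisection of `{1}`
(`s4Kernels_isGroupTrisection_holds`, `stabilize_isGroupTrisection_holds`, induction on `m`;
reused as `WaldhausenPairs.Negative.stabilizeIter_isGroupTrisection` from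
`Theorems/WaldhausenPairs/Negative/LoadBearing.lean`), so the pair quotient `S ⧸ ⟪N 0 ∪ N 1⟫`
is free of rank `m+1` (`IsGroupTrisection.free_pairQuotient`); with `M = ⟪N 0 ∪ N 1⟫ ⊇ N 0`,
Noether's third isomorphism theorem gives
`ψ : F ↠ F ⧸ π(M) ≅ S ⧸ M ≅ F_{m+1}` with kernel `π(M) = π(N 1) = Ū` (`M ≤ N 0 ⊔ N 1`,
`π(N 0) = 1`) (`hallClosure_exists_surjective_ker_eq`).  §2 M. Hall's theorem (1949;
Lyndon–Schupp Ch. I Prop. 3.10), in the tree as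
`Literature.GroupTheory.CombinatorialGroupTheory.sup_ker_eq_top_of_fg` (file
`Literature/GroupTheory/CombinatorialGroupTheory/FreeGroupSubgroupSeparable.lean`: finitely
generated subgroups of free groups are closed in the profinite topology, via the finite permutation
representation on a finite set of cosets; relative form along a surjection onto a free group):
`ψ(H)` is finitely generated and maps onto every finite quotient of `F_{m+1}`, hence is all of
`F_{m+1}`, i.e. `H ⊔ ker ψ = ⊤`. [folklore]
-/

-- the prescribed namespace `Summit.<P>.<Sub>.…` duplicates `SmoothPoincare4` (P = Sub)
set_option linter.dupNamespace false

open Literature.Topology.FourManifolds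

namespace Summit.SmoothPoincare4.SmoothPoincare4.Theorems.ShadowApproximation.FreeShadowTsystem

/-! ## §1 The quotient `F ⧸ Ū ≅ S ⧸ ⟪N 0 ∪ N 1⟫` is free of rank `m + 1` -/

/-- In `F = S ⧸ N 0`: the image of `⟪N 0 ∪ N 1⟫` is the image `Ū` of `N 1` (because
`⟪N 0 ∪ N 1⟫ = N 0 ⊔ N 1` for normal subgroups and `N 0` dies in `F`). [folklore] -/
theorem hallClosure_map_normalClosure_union (m : ℕ) :
    (Subgroup.normalClosure ((s4Kernels.stabilizeIter m 0 : Set (SurfaceGroup (3 + 3 * m))) ∪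
        (s4Kernels.stabilizeIter m 1 : Set (SurfaceGroup (3 + 3 * m))))).map
        (QuotientGroup.mk' (s4Kernels.stabilizeIter m 0)) =
      (s4Kernels.stabilizeIter m 1).map (QuotientGroup.mk' (s4Kernels.stabilizeIter m 0)) := by
  refine le_antisymm ?_ (Subgroup.map_mono fun x hx => Subgroup.subset_normalClosure (Or.inr hx))
  have hle : Subgroup.normalClosure
      ((s4Kernels.stabilizeIter m 0 : Set (SurfaceGroup (3 + 3 * m))) ∪
        (s4Kernels.stabilizeIter m 1 : Set (SurfaceGroup (3 + 3 * m)))) ≤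
      s4Kernels.stabilizeIter m 0 ⊔ s4Kernels.stabilizeIter m 1 :=
    Subgroup.normalClosure_le_normal (Set.union_subset
      (fun x hx => Subgroup.mem_sup_left hx) (fun x hx => Subgroup.mem_sup_right hx))
  refine (Subgroup.map_mono hle).trans ?_
  rw [Subgroup.map_sup, QuotientGroup.map_mk'_self, bot_sup_eq]

/-- **`F ⧸ Ū` is free of rank `m + 1`**, as a surjection: there is `ψ : F = S ⧸ N 0 ↠ F_{m+1}`
with `ker ψ = Ū = π(N 1)` — the composite `F ↠ F ⧸ π⟪N 0 ∪ N 1⟫ ≅ S ⧸ ⟪N 0 ∪ N 1⟫ ≅ F_{m+1}`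
(third isomorphism theorem and `free_pairQuotient 0 1` of the standard group trisection).
[folklore] -/
theorem hallClosure_exists_surjective_ker_eq (m : ℕ) :
    ∃ ψ : (SurfaceGroup (3 + 3 * m) ⧸ s4Kernels.stabilizeIter m 0) →* FreeGroup (Fin (m + 1)),
      Function.Surjective ψ ∧
        ψ.ker =
          (s4Kernels.stabilizeIter m 1).map (QuotientGroup.mk' (s4Kernels.stabilizeIter m 0)) := by
  obtain ⟨e⟩ := (WaldhausenPairs.Negative.stabilizeIter_isGroupTrisection m).free_pairQuotient 0 1
    (by decide)
  set M : Subgroup (SurfaceGroup (3 + 3 * m)) := Subgroup.normalClosure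
    ((s4Kernels.stabilizeIter m 0 : Set (SurfaceGroup (3 + 3 * m))) ∪
      (s4Kernels.stabilizeIter m 1 : Set (SurfaceGroup (3 + 3 * m)))) with hM
  have hle : s4Kernels.stabilizeIter m 0 ≤ M := fun x hx =>
    Subgroup.subset_normalClosure (Or.inl hx)
  set E := (QuotientGroup.quotientQuotientEquivQuotient _ M hle).trans e.symm with hE
  refine ⟨E.toMonoidHom.comp
      (QuotientGroup.mk' (M.map (QuotientGroup.mk' (s4Kernels.stabilizeIter m 0)))), ?_, ?_⟩
  · exact E.surjective.comp (QuotientGroup.mk'_surjective _)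
  · rw [MonoidHom.ker_comp_of_injective _ _ E.injective, QuotientGroup.ker_mk',
      hallClosure_map_normalClosure_union]

/-! ## §2 The stub -/

/-- **Stub `stub_hallClosure` of line `free-shadow-tsystem` (M. Hall's theorem, read in
`F ⧸ Ū ≅ F_{m+1}`).**  In `F = S ⧸ N 0`, a finitely generated subgroup `H` with `H ⊔ P = ⊤` for
every normal finite-index `P ⊇ Ū = π(N 1)` satisfies `H ⊔ Ū = ⊤`: along the surjection
`ψ : F ↠ F_{m+1}` with kernel `Ū` (`hallClosure_exists_surjective_ker_eq`), `ψ(H)` is a finitely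
generated subgroup of the free group `F_{m+1}` mapping onto every finite quotient, hence everything by
M. Hall's theorem (`Literature.GroupTheory.CombinatorialGroupTheory.sup_ker_eq_top_of_fg`;
Hall 1949, Lyndon–Schupp Ch. I Prop. 3.10). [folklore] -/
theorem stub_hallClosure :
    ∀ (m : ℕ) (H : Subgroup (SurfaceGroup (3 + 3 * m) ⧸ s4Kernels.stabilizeIter m 0)), H.FG →
      (∀ P : Subgroup (SurfaceGroup (3 + 3 * m) ⧸ s4Kernels.stabilizeIter m 0),
        P.Normal → P.FiniteIndex →
        (s4Kernels.stabilizeIter m 1).map (QuotientGroup.mk' (s4Kernels.stabilizeIter m 0)) ≤ P →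
        H ⊔ P = ⊤) →
      H ⊔ (s4Kernels.stabilizeIter m 1).map (QuotientGroup.mk' (s4Kernels.stabilizeIter m 0)) = ⊤ := by
  intro m H hH hP
  obtain ⟨ψ, hψ, hker⟩ := hallClosure_exists_surjective_ker_eq m
  rw [← hker]
  exact Literature.GroupTheory.CombinatorialGroupTheory.sup_ker_eq_top_of_fg ψ hψ H hH
    fun P hPn hPf hle => hP P hPn hPf (hker ▸ hle)

end Summit.SmoothPoincare4.SmoothPoincare4.Theorems.ShadowApproximation.FreeShadowTsystem
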